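import Literature.NumberTheory.GaloisCohomology.Howard2004.DualityDatumLocalCupPerfectProofs
import Literature.NumberTheory.GaloisCohomology.Howard2004.UnramifiedSelfOrthogonalReadout
import Literature.NumberTheory.GaloisRepresentations.GaloisCohomologyScalarAction
import HarnessLib

/-!
# Howard's induced local pairing `localCup`: the double annihilator of an `R`-STABLE condition for the
# `R(1)`-valued pairing itself, and the descent lemma with (Perf) on the images only (proofs)

`Proofs` file (theorems only; no definition, no named fact, no instance) in the currency of the cell's typing of
B. Howard, *The Heegner point Kolyvagin system*, Compositio Math. 140 (2004), §1.3 H.4 (`SelmerTriples.lean`: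
`DualityDatum`, `localCup : H¹(K_v, T) × H¹(K_v, Tw T) → H²(K_v, R(1))`; `DualityDatumTateDualBridge.lean`: the bridge
`H²(exp ∘ λ)(x ∪ y) = ⟨x, Θ_* y⟩_{Tate}`; `UnramifiedSelfOrthogonalReadout.lean`: the readout characters `λ_r = λ(r ·)`;
`DualityDatumLocalCupPerfectProofs.lean`: (Perf)/(Nondeg) for the `ℤ/p^k`-READING `ι_v ∘ H²(exp ∘ λ) ∘ localCup`, which
this file imports and reads back to `localCup` itself).

The descent of exact orthogonal complements along Howard's tower (`Tower.mem_levelCondition_top_of_forall_pairing_bot_eq_zero`,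
`TowerLiftableOfDualityProofs.lean`) takes at the finite level `k` two duality inputs: (Perf) «`y ⊥ T^⊥ ⇒ y ∈ T`» and (Nondeg)
«left kernel of the level pairing is trivial».  For Howard's `R(1)`-VALUED pairing a single character `λ : R → ℤ/p^k` does
not detect `H²(K_v, R(1))` (for `R = A_{m,k}`, `m ≥ 2`); the double-annihilator statement therefore holds for the
subgroups `T ≤ H¹(K_v, Tw T)` stable under the scalar action of `R` (all of Howard's local conditions are `R`-submodules,
Def. 1.1.1), read through a DUALIZING family `(r_i)` of `R` (`x ↦ (exp λ(r_i x))_i : R ≅ Π_i μ_{p^k}`):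

* §1 `toTateDual_lamMul`, `map_toTateDual_lamMul`: `Θ_{λ_r} = Θ_λ ∘ (r •)` on modules and on `H¹`; hence
  `cohomologyMap_expLam_lamMul_localCup`: `H²(exp ∘ λ_r)(x ∪ t) = H²(exp ∘ λ)(x ∪ (r • t))`.
* §2 `eq_zero_of_forall_cohomologyMap_expLam_lamMul_eq_zero`: the characters `exp ∘ λ_{r_i}` of a dualizing family detect
  `H²(K_v, R(1))` (the FAMILY form of `localTwoDetects_of_bijective`).
* §3 **`mem_of_forall_localCup_annihilator_eq_zero`** (Perf for `localCup` itself): for `ι_v` injective with both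
  adjoints of `(a, b) ↦ ι_v ⟨a, b⟩` injective (the clause `IsPerfect` of the hPT binder), `Θ = toTateDual λ exp` bijective,
  `T` an `R`-stable subgroup and `y` with «`∀ x, (∀ t ∈ T, x ∪ t = 0) → x ∪ y = 0`»: `y ∈ T` (the READING statement
  `mem_of_forall_localCupZMod_annihilator_eq_zero` of `DualityDatumLocalCupPerfectProofs` plus §§1–2; for a non-`R`-stable
  `T` the `R(1)`-valued double annihilator is `R · T`, not `T`); **`eq_zero_of_forall_localCup_eq_zero`** /
  **`eq_zero_of_forall_localCup_eq_zero_right`** (Nondeg for `localCup` itself, from `injective_localCupZMod[_flip]`);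
  the `_of_isPerfect` forms taking `inv : LocalInvariants K (p^k)`, `inv.IsPerfect`; and (§0)
  `Tower.mem_levelCondition_top_of_forall_pairing_bot_eq_zero_of_range` — the descent lemma with (Perf) required only on
  the images `range (red'^{(d)})` (which are `R`-stable for Howard's towers, the reductions being `R`-linear).
* §4 (appended) `scalarMapH1_cohomologyMap_of_semilinear` (`H¹(φ a •) ∘ H¹(r) = H¹(r) ∘ H¹(a •)` for `r`
  `φ`-semilinear equivariant, `ContinuousRep.cohomologyMap` currency), `exists_scalarMapH1_cohomologyMap_eq_of_surjective`,
  `scalarMapH1_mem_range_cohomologyMap_of_surjective`, `DualityDatum.scalarMapH1_twist_toLocal_mem_range` — the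
  hypothesis `hT` of §3 at `T = range H¹(K_v, Tw red)` for a reduction with surjective ring map.

Cell `pub/bsd-print-x9` (H.4 at the places `v ∈ Σ` of the Eisenstein setting); nothing arithmetic is proved here; BSD is not
proved by any of this.

References: [Howard2004HeegnerKolyvagin] §1.3 H.4 (arXiv:1202.6340 p. 7, L69–82), Def. 1.1.1, §1.6; [MilneADT2006] I §0
Prop. 0.19, I Cor. 2.3 (local Tate duality); [NeukirchSchmidtWingberg2008] I §4 (1.4.2).
-/

set_option autoImplicit false

noncomputable section

open CategoryTheory Function NumberField IsDedekindDomain Field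
open scoped ContRepresentation NumberField

/-! ## §0 The descent lemma with (Perf) on the images of the iterated reductions only -/

namespace Literature.NumberTheory.EllipticCurves.Tower

universe u v w

variable {X : ℕ → Type u} [∀ j, AddCommGroup (X j)] (red : ∀ j, X (j + 1) →+ X j)
variable {Y : ℕ → Type v} [∀ j, AddCommGroup (Y j)] (red' : ∀ j, Y (j + 1) →+ Y j)
variable {Q : ℕ → Type w} [∀ j, AddCommGroup (Q j)] (B : ∀ j, X j →+ Y j →+ Q j)

/-- **(Dual) from four level inputs, with (Perf) required only on the images `red'^{(d)}(Y_{k+d})`** (the subgroups to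
which the proof of `mem_levelCondition_top_of_forall_pairing_bot_eq_zero` applies it; for Howard's `R(1)`-valued
pairings these images are `R`-stable and (Perf) holds for them, `DualityDatum.mem_of_forall_localCup_annihilator_eq_zero`).
[cite: MilneADT2006, Ch. I §0 Prop. 0.19 and Cor. 2.3] [cite: Howard2004HeegnerKolyvagin, H.4 (arXiv p. 7, L78–82)] -/
theorem mem_levelCondition_top_of_forall_pairing_bot_eq_zero_of_range [∀ j, Finite (Y j)] (p : ℕ) (k : ℕ)
    (up : ∀ d : ℕ, X k →+ X (k + d)) (incQ : ∀ d : ℕ, Q k →+ Q (k + d))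
    (hPerf : ∀ (d : ℕ) (y : Y k),
      (∀ x : X k, (∀ t ∈ (redIter red' k d).range, B k x t = 0) → B k x y = 0) → y ∈ (redIter red' k d).range)
    (hAdj : ∀ (d : ℕ) (x : X k) (w : Y (k + d)),
      incQ d (B k x (redIter red' k d w)) = B (k + d) (up d x) w)
    (hNondeg : ∀ (d : ℕ) (x : X (k + d)), (∀ w : Y (k + d), B (k + d) x w = 0) → x = 0)
    (hKer : ∀ (d : ℕ) (x : X k), up d x = 0 →
      x ∈ levelCondition red p (fun _ ↦ (⊥ : AddSubgroup (X _))) k)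
    (y : Y k) (hy : ∀ x ∈ levelCondition red p (fun _ ↦ (⊥ : AddSubgroup (X _))) k, B k x y = 0) :
    y ∈ levelCondition red' p (fun _ ↦ (⊤ : AddSubgroup (Y _))) k := by
  refine mem_levelCondition_top_of_forall_mem_range red' p k y fun d ↦ ?_
  refine hPerf d y fun x hx ↦ hy x (hKer d x (hNondeg d (up d x) fun w ↦ ?_))
  rw [← hAdj, hx _ ⟨w, rfl⟩, map_zero]

end Literature.NumberTheory.EllipticCurves.Tower

namespace Literature.NumberTheory.GaloisCohomology.Howard2004

open Literature.NumberTheory.GaloisRepresentations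
open Literature.NumberTheory.GaloisRepresentations.DiscreteGaloisModule

variable {K : Type} [Field K] [NumberField K] {M : Type} [AddCommGroup M] [TopologicalSpace M]
  [DiscreteTopology M] {R : Type} [CommRing R] [Module R M] [TopologicalSpace R] [DiscreteTopology R]
  {p : ℕ} [Fact p.Prime] [Algebra ℤ_[p] R] {cd : ConjugationDatum K} {ρ : DiscreteGaloisModule K M}
  (D : DualityDatum p cd ρ R) {k : ℕ}
  (lam : R →+ ZMod (p ^ k))
  (hlam : ∀ (z : ℤ_[p]) (r : R), lam (algebraMap ℤ_[p] R z * r) = PadicInt.toZModPow k z * lam r)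
  (exp : ZMod (p ^ k) →+ MuCarrier K (p ^ k))
  (hexp : ∀ (g : absoluteGaloisGroup K) (x : ZMod (p ^ k)),
    exp (cyclotomicCharacterModPow K p k g * x) = mu K (p ^ k) g (exp x))

namespace DualityDatum

/-! ## §1 `Θ_{λ_r} = Θ_λ ∘ (r •)` and `H²(exp ∘ λ_r)(x ∪ t) = H²(exp ∘ λ)(x ∪ r•t)` -/

/-- `Θ_{λ_r} t = Θ_λ (r • t)`: `exp λ(r e(s,t)) = exp λ(e(s, r t))`. [cite: Howard2004HeegnerKolyvagin, §1.3 H.4 (arXiv p. 7, L69–76: e is R-bilinear)] -/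
theorem toTateDual_lamMul [Finite M] (r : R) (t : M) :
    D.toTateDual (lamMul lam r) (lamMul_semilinear lam hlam r) exp hexp t = D.toTateDual lam hlam exp hexp (r • t) := by
  refine HomCarrier.ext fun s => ?_
  change exp (lamMul lam r (D.e s t)) = exp (lam (D.e s (r • t)))
  rw [lamMul_apply, map_smul, smul_eq_mul]

omit [TopologicalSpace R] [DiscreteTopology R] in
/-- The twisted module is `R`-linear when `T` is. [cite: Howard2004HeegnerKolyvagin, §1.3 (Tw T has underlying R-module T)] -/
theorem isScalarLinear_twist_toLocal (cd' : ConjugationDatum K) {ρ' : DiscreteGaloisModule K M}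
    (hρ' : ρ'.IsScalarLinear R) (v : Place K) : IsScalarLinear R ((cd'.twist ρ').toLocal v) :=
  (IsScalarLinear.restrict hρ' cd'.conj).restrictField (Place.Completion v)

/-- **`H¹(Θ_{λ_r}) = H¹(Θ_λ) ∘ (r •)`** on `H¹(K_v, Tw T)`. [cite: Howard2004HeegnerKolyvagin, §1.3 H.4] [cite: SerreGaloisCohomology1997, I §2.2] -/
theorem map_toTateDual_lamMul [Finite M] (hρ : ρ.IsScalarLinear R) (v : Place K) (r : R)
    (t : galoisCohomology ((cd.twist ρ).toLocal v) 1) :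
    galoisCohomology.map (EllipticCurves.DiscreteGaloisModule.localMap
        (D.toTateDual (lamMul lam r) (lamMul_semilinear lam hlam r) exp hexp) v) 1 t =
      galoisCohomology.map (EllipticCurves.DiscreteGaloisModule.localMap (D.toTateDual lam hlam exp hexp) v) 1
        (galoisCohomology.scalarMapH1 ((cd.twist ρ).toLocal v) (isScalarLinear_twist_toLocal cd hρ v) r t) := by
  obtain ⟨φ, rfl⟩ := oneCocycleClass_surjective _ t
  rw [galoisCohomology.scalarMapH1_oneCocycleClass]
  change ContinuousCohomology.map _ _ 1 _ = ContinuousCohomology.map _ _ 1 _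
  rw [map_oneCocycleClass, map_oneCocycleClass]
  congr 1
  refine Subtype.ext (ContinuousMap.ext fun σ => ?_)
  rw [contOneCocycles.pullback_apply, contOneCocycles.pullback_apply]
  change EllipticCurves.DiscreteGaloisModule.localMap
      (D.toTateDual (lamMul lam r) (lamMul_semilinear lam hlam r) exp hexp) v (φ.1 σ) =
    EllipticCurves.DiscreteGaloisModule.localMap (D.toTateDual lam hlam exp hexp) v
      ((galoisCohomology.scalarCocycle ((cd.twist ρ).toLocal v) (isScalarLinear_twist_toLocal cd hρ v) r φ).1 σ)
  rw [EllipticCurves.DiscreteGaloisModule.localMap_apply, EllipticCurves.DiscreteGaloisModule.localMap_apply,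
    galoisCohomology.scalarCocycle_apply, toTateDual_lamMul]

/-- **`H²(exp ∘ λ_r)(x ∪ t) = H²(exp ∘ λ)(x ∪ r•t)`** (both equal `⟨x, Θ_λ,* (r•t)⟩_{Tate}` by the bridge).
[cite: Howard2004HeegnerKolyvagin, §1.3 H.4 (arXiv p. 7, L78–82)] [cite: NeukirchSchmidtWingberg2008, I §4 (1.4.2)] -/
theorem cohomologyMap_expLam_lamMul_localCup [Finite M] (hρ : ρ.IsScalarLinear R) (v : Place K) (r : R)
    (x : galoisCohomology (ρ.toLocal v) 1) (t : galoisCohomology ((cd.twist ρ).toLocal v) 1) :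
    cohomologyMap (D.expLamLocalHom (lamMul lam r) (lamMul_semilinear lam hlam r) exp hexp v) 2 (D.localCup v x t) =
      cohomologyMap (D.expLamLocalHom lam hlam exp hexp v) 2
        (D.localCup v x (galoisCohomology.scalarMapH1 ((cd.twist ρ).toLocal v) (isScalarLinear_twist_toLocal cd hρ v) r t)) := by
  rw [D.cohomologyMap_localCup_eq_localTatePairing, D.cohomologyMap_localCup_eq_localTatePairing,
    D.map_toTateDual_lamMul lam hlam exp hexp hρ v r t]

/-! ## §2 The characters of a dualizing family detect `H²(K_v, R(1))` -/

include hlam in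
/-- **Family readout**: if `x ↦ (exp λ(r_i x))_i : R → Π_i μ_{p^k}` is bijective then a class `z ∈ H²(K_v, R(1))` with
`H²(exp ∘ λ_{r_i}) z = 0` for every `i` vanishes (`twoCohomology_eq_zero_of_forall_cohomologyMap_eq_zero`).
[cite: Howard2004HeegnerKolyvagin, §1.3 H.4 (arXiv p. 7, L78–82)] [cite: Brown1982CohomologyGroups, III §6] -/
theorem eq_zero_of_forall_cohomologyMap_expLam_lamMul_eq_zero {ι : Type} [Finite ι] (r : ι → R)
    (hbij : Bijective fun x : R => fun i : ι => exp (lam (r i * x))) (v : Place K)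
    (z : galoisCohomology (D.twistOne.toLocal v) 2)
    (hz : ∀ i, cohomologyMap (D.expLamLocalHom (lamMul lam (r i)) (lamMul_semilinear lam hlam (r i)) exp hexp v) 2 z = 0) :
    z = 0 := by
  haveI : CompactSpace (absoluteGaloisGroup (Place.Completion v)) := absoluteGaloisGroup_compactSpace _
  let π : ∀ i : ι, (D.twistOne.toLocal v).toTopRep ⟶ ((mu K (p ^ k)).toLocal v).toTopRep := fun i =>
    D.expLamLocalHom (lamMul lam (r i)) (lamMul_semilinear lam hlam (r i)) exp hexp v
  let e : R ≃ (ι → MuCarrier K (p ^ k)) := Equiv.ofBijective _ hbij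
  refine twoCohomology_eq_zero_of_forall_cohomologyMap_eq_zero π (fun y => e.symm y)
    continuous_of_discreteTopology (fun y i => ?_) (fun x => ?_) z fun i => hz i
  · change e (e.symm y) i = y i
    rw [Equiv.apply_symm_apply]
  · change e.symm (fun i => e x i) = x
    exact e.symm_apply_apply x

/-! ## §3 (Perf) and (Nondeg) for `localCup` itself -/

/-- **(Nondeg, left) for `localCup`**: if `x ∪ y = 0` for all `y ∈ H¹(K_v, Tw T)` then `x = 0` — from the injectivity of the
`ℤ/p^k`-reading (`injective_localCupZMod`). [cite: MilneADT2006, Ch. I Cor. 2.3]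
[cite: Howard2004HeegnerKolyvagin, §1.3 H.4 (arXiv p. 7, L78–82)] -/
theorem eq_zero_of_forall_localCup_eq_zero [Finite M] (hΘ : Bijective (D.toTateDual lam hlam exp hexp)) (v : Place K)
    (ι₀ : galoisCohomology ((mu K (p ^ k)).toLocal v) 2 →+ ZMod (p ^ k))
    (hιL : Injective (localTatePairingZMod ρ (p ^ k) v ι₀))
    (x : galoisCohomology (ρ.toLocal v) 1)
    (hx : ∀ y : galoisCohomology ((cd.twist ρ).toLocal v) 1, D.localCup v x y = 0) : x = 0 := by
  refine (injective_iff_map_eq_zero _).mp (D.injective_localCupZMod lam hlam exp hexp hΘ v ι₀ hιL) x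
    (AddMonoidHom.ext fun y ↦ ?_)
  rw [AddMonoidHom.zero_apply, ← D.localCupZMod_apply lam hlam exp hexp, hx y]
  exact (congrArg ι₀ (map_zero _)).trans (map_zero _)

/-- **(Nondeg, right) for `localCup`**: if `x ∪ y = 0` for all `x` then `y = 0` (`injective_localCupZMod_flip`).
[cite: MilneADT2006, Ch. I Cor. 2.3] [cite: Howard2004HeegnerKolyvagin, §1.3 H.4 (arXiv p. 7, L78–82)] -/
theorem eq_zero_of_forall_localCup_eq_zero_right [Finite M] (hΘ : Bijective (D.toTateDual lam hlam exp hexp))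
    (v : Place K) (ι₀ : galoisCohomology ((mu K (p ^ k)).toLocal v) 2 →+ ZMod (p ^ k))
    (hιR : Injective (localTatePairingZMod ρ (p ^ k) v ι₀).flip)
    (y : galoisCohomology ((cd.twist ρ).toLocal v) 1)
    (hy : ∀ x : galoisCohomology (ρ.toLocal v) 1, D.localCup v x y = 0) : y = 0 := by
  refine (injective_iff_map_eq_zero _).mp (D.injective_localCupZMod_flip lam hlam exp hexp hΘ v ι₀ hιR) y
    (AddMonoidHom.ext fun x ↦ ?_)
  rw [AddMonoidHom.zero_apply, AddMonoidHom.flip_apply, ← D.localCupZMod_apply lam hlam exp hexp, hy x]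
  exact (congrArg ι₀ (map_zero _)).trans (map_zero _)

section Perfect

variable [Finite M] (hρ : ρ.IsScalarLinear R) (v : HeightOneSpectrum (𝓞 K))

/-- **(Perf) The double annihilator of an `R`-stable condition, for `localCup` itself.**  Let `(r_i)` be a dualizing family
of `R` for `(λ, exp)` (`x ↦ (exp λ(r_i x))_i` bijective), `ι_v : H²(K_v, μ_{p^k}) → ℤ/p^k` injective with both adjoints of
`ι_v ⟨·, ·⟩_v` injective on `H¹(K_v, T) × H¹(K_v, T^∨(1))`, `Θ` bijective, and `T ≤ H¹(K_v, Tw T)` a subgroup stable under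
every `r_i •`.  If `y` satisfies «`∀ x, (∀ t ∈ T, x ∪ t = 0) → x ∪ y = 0`» then `y ∈ T` — the hypothesis (Perf) of
`Tower.mem_levelCondition_top_of_forall_pairing_bot_eq_zero_of_range` for Howard's induced local pairing (read the
hypothesis through `ι_v ∘ H²(exp ∘ λ_{r_i})`, §§1–2, and apply `mem_of_forall_localCupZMod_annihilator_eq_zero`).
[cite: MilneADT2006, Ch. I §0 Prop. 0.19 and Cor. 2.3]
[cite: Howard2004HeegnerKolyvagin, §1.3 H.4 (arXiv p. 7, L78–82) and Def. 1.1.1 (local conditions are R-submodules)] -/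
theorem mem_of_forall_localCup_annihilator_eq_zero (hM : ∀ m : M, (p ^ k) • m = 0)
    (hΘ : Bijective (D.toTateDual lam hlam exp hexp))
    (ι₀ : galoisCohomology ((mu K (p ^ k)).toLocal (Sum.inr v : Place K)) 2 →+ ZMod (p ^ k)) (hι₀ : Injective ι₀)
    (hιL : Injective (localTatePairingZMod ρ (p ^ k) (Sum.inr v) ι₀))
    (hιR : Injective (localTatePairingZMod ρ (p ^ k) (Sum.inr v) ι₀).flip)
    {ι : Type} [Finite ι] (r : ι → R) (hbij : Bijective fun x : R => fun i : ι => exp (lam (r i * x)))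
    (T : AddSubgroup (galoisCohomology ((cd.twist ρ).toLocal (Sum.inr v)) 1))
    (hT : ∀ i, ∀ t ∈ T, galoisCohomology.scalarMapH1 ((cd.twist ρ).toLocal (Sum.inr v))
      (isScalarLinear_twist_toLocal cd hρ (Sum.inr v)) (r i) t ∈ T)
    (y : galoisCohomology ((cd.twist ρ).toLocal (Sum.inr v)) 1)
    (hy : ∀ x : galoisCohomology (ρ.toLocal (Sum.inr v)) 1,
      (∀ t ∈ T, D.localCup (Sum.inr v) x t = 0) → D.localCup (Sum.inr v) x y = 0) :
    y ∈ T := by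
  refine D.mem_of_forall_localCupZMod_annihilator_eq_zero lam hlam exp hexp hM hΘ v ι₀ hιL hιR T y fun x hx ↦ ?_
  -- `x ⊥ T` under the reading ⇒ `x ∪ t = 0` for all `t ∈ T` (readout through the family `λ_{r_i}`, `T` being `r_i`-stable)
  have hxT : ∀ t ∈ T, D.localCup (Sum.inr v) x t = 0 := fun t ht ↦ by
    refine D.eq_zero_of_forall_cohomologyMap_expLam_lamMul_eq_zero lam hlam exp hexp r hbij (Sum.inr v) _ fun i ↦ ?_
    rw [D.cohomologyMap_expLam_lamMul_localCup lam hlam exp hexp hρ]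
    exact hι₀ ((hx _ (hT i t ht)).trans (map_zero _).symm)
  rw [hy x hxT]
  exact (congrArg ι₀ (map_zero _)).trans (map_zero _)

/-- **(Perf) for `localCup` itself from the Poitou–Tate family**: with `inv : LocalInvariants K (p^k)` satisfying `IsPerfect`
(first conjunct of `poitouTate_selmerStructure_duality K`). [cite: MilneADT2006, Ch. I §0 Prop. 0.19 and Cor. 2.3]
[cite: Howard2004HeegnerKolyvagin, §1.3 H.4 (arXiv p. 7, L78–82) and Def. 1.1.1] -/
theorem mem_of_forall_localCup_annihilator_eq_zero_of_isPerfect (hM : ∀ m : M, (p ^ k) • m = 0)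
    (hΘ : Bijective (D.toTateDual lam hlam exp hexp)) (inv : LocalInvariants K (p ^ k)) (hperf : inv.IsPerfect)
    {ι : Type} [Finite ι] (r : ι → R) (hbij : Bijective fun x : R => fun i : ι => exp (lam (r i * x)))
    (T : AddSubgroup (galoisCohomology ((cd.twist ρ).toLocal (Sum.inr v)) 1))
    (hT : ∀ i, ∀ t ∈ T, galoisCohomology.scalarMapH1 ((cd.twist ρ).toLocal (Sum.inr v))
      (isScalarLinear_twist_toLocal cd hρ (Sum.inr v)) (r i) t ∈ T)
    (y : galoisCohomology ((cd.twist ρ).toLocal (Sum.inr v)) 1)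
    (hy : ∀ x : galoisCohomology (ρ.toLocal (Sum.inr v)) 1,
      (∀ t ∈ T, D.localCup (Sum.inr v) x t = 0) → D.localCup (Sum.inr v) x y = 0) :
    y ∈ T :=
  D.mem_of_forall_localCup_annihilator_eq_zero lam hlam exp hexp hρ v hM hΘ _ (hperf v).1.1 ((hperf v).2 ρ hM).1.1
    ((hperf v).2 ρ hM).2.1 r hbij T hT y hy

/-- **(Nondeg) for `localCup` itself from the Poitou–Tate family**: both kernels of `localCup (inr v)` are trivial.
[cite: MilneADT2006, Ch. I Cor. 2.3] [cite: Howard2004HeegnerKolyvagin, §1.3 H.4 (arXiv p. 7, L78–82)] -/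
theorem eq_zero_of_forall_localCup_eq_zero_of_isPerfect (hM : ∀ m : M, (p ^ k) • m = 0)
    (hΘ : Bijective (D.toTateDual lam hlam exp hexp)) (inv : LocalInvariants K (p ^ k)) (hperf : inv.IsPerfect) :
    (∀ x : galoisCohomology (ρ.toLocal (Sum.inr v)) 1,
        (∀ y : galoisCohomology ((cd.twist ρ).toLocal (Sum.inr v)) 1, D.localCup (Sum.inr v) x y = 0) → x = 0) ∧
      ∀ y : galoisCohomology ((cd.twist ρ).toLocal (Sum.inr v)) 1,
        (∀ x : galoisCohomology (ρ.toLocal (Sum.inr v)) 1, D.localCup (Sum.inr v) x y = 0) → y = 0 :=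
  ⟨fun x hx ↦ D.eq_zero_of_forall_localCup_eq_zero lam hlam exp hexp hΘ _ _ ((hperf v).2 ρ hM).1.1 x hx,
    fun y hy ↦ D.eq_zero_of_forall_localCup_eq_zero_right lam hlam exp hexp hΘ _ _ ((hperf v).2 ρ hM).2.1 y hy⟩

end Perfect

end DualityDatum

/-! ## §4 `R`-stability of the images of semilinear equivariant maps (discharging `hT` at `T = range H¹(red^{(d)})`) -/

/-- **The scalar action commutes with `H¹` of a SEMILINEAR equivariant map** (in the `ContinuousRep.cohomologyMap`
currency of `DVRSetting.cond_red`): for `R₂`-, `R₁`-linear discrete Galois modules `T₂`, `T₁`, an equivariant additive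
`r : T₂ → T₁` and `φ : R₂ → R₁` with `r (a • m) = φ(a) • r m` (e.g. the reduction `T/𝔪^{k+d} → T/𝔪^k` over
`R/𝔪^{k+d} → R/𝔪^k`), `H¹(φ a •) (H¹(r) w) = H¹(r) (H¹(a •) w)` (both are `[σ ↦ r (a • c σ)]`).
[cite: SerreGaloisCohomology1997, Ch. I §2.2 (functoriality of H¹ in the coefficients) and §5.1]
[cite: Howard2004HeegnerKolyvagin, Def. 1.1.1 and Def. 1.1.3 (arXiv p. 5: morphisms of Quot(T) are R-linear)] -/
theorem scalarMapH1_cohomologyMap_of_semilinear {L : Type} [Field L]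
    {M₁ : Type} [AddCommGroup M₁] [TopologicalSpace M₁] [DiscreteTopology M₁]
    {M₂ : Type} [AddCommGroup M₂] [TopologicalSpace M₂] [DiscreteTopology M₂]
    {R₁ : Type*} [Ring R₁] [Module R₁ M₁] {R₂ : Type*} [Ring R₂] [Module R₂ M₂]
    {ρ₁ : DiscreteGaloisModule L M₁} {ρ₂ : DiscreteGaloisModule L M₂}
    (hρ₁ : ρ₁.IsScalarLinear R₁) (hρ₂ : ρ₂.IsScalarLinear R₂) (r : M₂ →+ M₁)
    (hr : ∀ (g : absoluteGaloisGroup L) (m : M₂), r (ρ₂ g m) = ρ₁ g (r m)) (φ : R₂ → R₁)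
    (hsemi : ∀ (a : R₂) (m : M₂), r (a • m) = φ a • r m) (a : R₂) (w : galoisCohomology ρ₂ 1) :
    galoisCohomology.scalarMapH1 ρ₁ hρ₁ (φ a)
        (ContinuousRep.cohomologyMap ρ₂ ρ₁ r continuous_of_discreteTopology hr 1 w) =
      ContinuousRep.cohomologyMap ρ₂ ρ₁ r continuous_of_discreteTopology hr 1
        (galoisCohomology.scalarMapH1 ρ₂ hρ₂ a w) := by
  obtain ⟨c, rfl⟩ := oneCocycleClass_surjective _ w
  rw [galoisCohomology.scalarMapH1_oneCocycleClass]
  change galoisCohomology.scalarMapH1 ρ₁ hρ₁ (φ a) (ContinuousCohomology.map _ _ 1 (oneCocycleClass _ c)) =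
    ContinuousCohomology.map _ _ 1 (oneCocycleClass _ (galoisCohomology.scalarCocycle ρ₂ hρ₂ a c))
  rw [map_oneCocycleClass, map_oneCocycleClass, galoisCohomology.scalarMapH1_oneCocycleClass]
  exact congrArg _ (Subtype.ext (ContinuousMap.ext fun σ => (hsemi a (c.1 σ)).symm))

/-- **The image of `H¹` of a semilinear equivariant map with SURJECTIVE ring map is `R₁`-stable**: for every
`a₁ ∈ R₁` and `w`, `H¹(a₁ •) (H¹(r) w) = H¹(r) w'` for some `w'` — the hypothesis `hT` of
`DualityDatum.mem_of_forall_localCup_annihilator_eq_zero` at `T = range H¹(red^{(d)})`.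
[cite: SerreGaloisCohomology1997, Ch. I §2.2 and §5.1] [cite: Howard2004HeegnerKolyvagin, Def. 1.1.1 and Def. 1.1.3 (arXiv p. 5)] -/
theorem exists_scalarMapH1_cohomologyMap_eq_of_surjective {L : Type} [Field L]
    {M₁ : Type} [AddCommGroup M₁] [TopologicalSpace M₁] [DiscreteTopology M₁]
    {M₂ : Type} [AddCommGroup M₂] [TopologicalSpace M₂] [DiscreteTopology M₂]
    {R₁ : Type*} [Ring R₁] [Module R₁ M₁] {R₂ : Type*} [Ring R₂] [Module R₂ M₂]
    {ρ₁ : DiscreteGaloisModule L M₁} {ρ₂ : DiscreteGaloisModule L M₂}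
    (hρ₁ : ρ₁.IsScalarLinear R₁) (hρ₂ : ρ₂.IsScalarLinear R₂) (r : M₂ →+ M₁)
    (hr : ∀ (g : absoluteGaloisGroup L) (m : M₂), r (ρ₂ g m) = ρ₁ g (r m)) (φ : R₂ → R₁) (hφ : Surjective φ)
    (hsemi : ∀ (a : R₂) (m : M₂), r (a • m) = φ a • r m) (a₁ : R₁) (w : galoisCohomology ρ₂ 1) :
    ∃ w' : galoisCohomology ρ₂ 1,
      galoisCohomology.scalarMapH1 ρ₁ hρ₁ a₁ (ContinuousRep.cohomologyMap ρ₂ ρ₁ r continuous_of_discreteTopology hr 1 w) =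
        ContinuousRep.cohomologyMap ρ₂ ρ₁ r continuous_of_discreteTopology hr 1 w' := by
  obtain ⟨a, rfl⟩ := hφ a₁
  exact ⟨_, scalarMapH1_cohomologyMap_of_semilinear hρ₁ hρ₂ r hr φ hsemi a w⟩

/-- **`range H¹(r)` is stable under the scalar action**, as a statement about `AddMonoidHom.range` (the form of `hT`).
[cite: SerreGaloisCohomology1997, Ch. I §2.2 and §5.1] [cite: Howard2004HeegnerKolyvagin, Def. 1.1.1 and Def. 1.1.3 (arXiv p. 5)] -/
theorem scalarMapH1_mem_range_cohomologyMap_of_surjective {L : Type} [Field L]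
    {M₁ : Type} [AddCommGroup M₁] [TopologicalSpace M₁] [DiscreteTopology M₁]
    {M₂ : Type} [AddCommGroup M₂] [TopologicalSpace M₂] [DiscreteTopology M₂]
    {R₁ : Type*} [Ring R₁] [Module R₁ M₁] {R₂ : Type*} [Ring R₂] [Module R₂ M₂]
    {ρ₁ : DiscreteGaloisModule L M₁} {ρ₂ : DiscreteGaloisModule L M₂}
    (hρ₁ : ρ₁.IsScalarLinear R₁) (hρ₂ : ρ₂.IsScalarLinear R₂) (r : M₂ →+ M₁)
    (hr : ∀ (g : absoluteGaloisGroup L) (m : M₂), r (ρ₂ g m) = ρ₁ g (r m)) (φ : R₂ → R₁) (hφ : Surjective φ)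
    (hsemi : ∀ (a : R₂) (m : M₂), r (a • m) = φ a • r m) (a₁ : R₁) (t : galoisCohomology ρ₁ 1)
    (ht : t ∈ (ContinuousRep.cohomologyMap ρ₂ ρ₁ r continuous_of_discreteTopology hr 1).range) :
    galoisCohomology.scalarMapH1 ρ₁ hρ₁ a₁ t ∈
      (ContinuousRep.cohomologyMap ρ₂ ρ₁ r continuous_of_discreteTopology hr 1).range := by
  obtain ⟨w, rfl⟩ := ht
  obtain ⟨w', hw'⟩ := exists_scalarMapH1_cohomologyMap_eq_of_surjective hρ₁ hρ₂ r hr φ hφ hsemi a₁ w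
  exact ⟨w', hw'.symm⟩

namespace DualityDatum

omit [TopologicalSpace R] [DiscreteTopology R] in
/-- **`hT` of `mem_of_forall_localCup_annihilator_eq_zero` for the image of a tower reduction at the twist**: with
`ρ₁`, `ρ₂` `R₁`-, `R₂`-linear, `r : T₂ → T₁` equivariant and `φ`-semilinear for a surjective `φ : R₂ → R₁`, the range
of `H¹(K_v, Tw r) : H¹(K_v, Tw T₂) → H¹(K_v, Tw T₁)` is stable under `H¹(r_i •)` for every family `(r_i)` of `R₁`.
[cite: Howard2004HeegnerKolyvagin, §1.3 H.4 and Def. 1.1.1 (local conditions are R-submodules)]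
[cite: SerreGaloisCohomology1997, Ch. I §2.2 and §5.1] -/
theorem scalarMapH1_twist_toLocal_mem_range {M₂ : Type} [AddCommGroup M₂] [TopologicalSpace M₂]
    [DiscreteTopology M₂] {R₂ : Type} [CommRing R₂] [Module R₂ M₂] {ρ₂ : DiscreteGaloisModule K M₂}
    (hρ : ρ.IsScalarLinear R) (hρ₂ : ρ₂.IsScalarLinear R₂) (r : M₂ →+ M)
    (hr : ∀ (g : absoluteGaloisGroup K) (m : M₂), r (ρ₂ g m) = ρ g (r m)) (φ : R₂ → R) (hφ : Surjective φ)
    (hsemi : ∀ (a : R₂) (m : M₂), r (a • m) = φ a • r m) (v : Place K) {ι : Type} (rfam : ι → R) (i : ι)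
    (t : galoisCohomology ((cd.twist ρ).toLocal v) 1)
    (ht : t ∈ (ContinuousRep.cohomologyMap ((cd.twist ρ₂).toLocal v) ((cd.twist ρ).toLocal v) r
      continuous_of_discreteTopology (fun _ m => hr _ m) 1).range) :
    galoisCohomology.scalarMapH1 ((cd.twist ρ).toLocal v) (isScalarLinear_twist_toLocal cd hρ v) (rfam i) t ∈
      (ContinuousRep.cohomologyMap ((cd.twist ρ₂).toLocal v) ((cd.twist ρ).toLocal v) r
        continuous_of_discreteTopology (fun _ m => hr _ m) 1).range :=
  scalarMapH1_mem_range_cohomologyMap_of_surjective (isScalarLinear_twist_toLocal cd hρ v)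
    (isScalarLinear_twist_toLocal cd hρ₂ v) r (fun _ m => hr _ m) φ hφ hsemi (rfam i) t ht

end DualityDatum

end Literature.NumberTheory.GaloisCohomology.Howard2004

end
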